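import Summits.CriticalPhenomena.Ising3DConformalLimit.Theorems.PrecisionLaplacianDirectCorrelationStableTailSlabModeExpDecayDiagLineHolAux
import Summits.CriticalPhenomena.Ising3DConformalLimit.Theorems.PrecisionLaplacianDirectCorrelationStableTailPickInversionAux12
import Summits.CriticalPhenomena.Ising3DConformalLimit.Theorems.PrecisionLaplacianDirectCorrelationStableTailPickInversionAux17

/-!
# Diagonal line holomorphy, auxiliary file 9: from moments to the holomorphic extension along a
# diagonal line; the uniform bound off the reciprocal lattice; lattice symmetries; frame geometry

Helper file for the sub-stub `stub_slabModeExpDecay_auxDiagLineHol` (brick of `stub_slabModeExpDecay`)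
of line `self-energy-pick-inversion`, crux `PrecisionLaplacian.DirectCorrelationStableTail`
(stmt-CriticalPhenomena-4799). Pure theorem file.

* `exists_holoExt_of_cos_moments` : an even continuous `2π`-periodic `γ` whose cosine transforms are
  the moments of a finite positive measure `ν` on `[-1, 1]` extends, along `s ↦ γ(θ₀ + s/2)`, to a
  holomorphic function on any disc where `|sin(θ₀ + Re z/2)| ≥ m₀ > 0`, bounded by `ν(ℝ)/(2π m₀²)`
  (files 1 and `sin_le_abs_sin_of_forall_le`);
* `exists_green_bound_of_margin` : the Green symbol function `(1 - φ)⁻¹` is positive and bounded by a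
  constant `C(m)` at every momentum at sup-distance `≥ m` from `(2πℤ)³` (compactness and periodicity);
* `symbol_signedPerm` : invariance of the symbol under signed coordinate permutations of the momentum
  when the step law is invariant under the corresponding lattice map;
* frame geometry: `exists_signedPerm_of_diagFrame` (registered sub-goal
  `stub_slabModeExpDecay_auxDiagLineHol11`: every diagonal frame `e_i ± e_j` is a signed coordinate
  permutation of `e₀ + e₁`), `norm_signedPerm`, `exists_lattice_shift_reduced`, `good_of_reduced_le`,
  `dist_pi_int_of_dist_two_pi_int`.
-/

noncomputable section

namespace Summit.CriticalPhenomena.Ising3DConformalLimit.Cruxes.DirectCorrelationStableTail.SelfEnergyPickInversion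

open MeasureTheory Filter Topology Finset Real Literature.Probability.LatticeModels
open scoped BigOperators
open Summit.CriticalPhenomena.Ising3DConformalLimit.Theorems.EtaBoundsTransfer
  (continuous_phase continuous_fourier_q abs_fourier_q_le_one integrableOn_cube_of_continuous
    volume_cube_lt_top)

variable {q : Site 3 → ℝ} {P : ℕ → Site 3 → ℝ}

/-! ### The holomorphic extension along a line -/

/-- `|sin t| ≥ sin δ` when `t` keeps distance `≥ δ ≥ 0` from `πℤ`. [folklore] -/
theorem sin_le_abs_sin_of_forall_le {t δ : ℝ} (hδ0 : 0 ≤ δ)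
    (h : ∀ k : ℤ, δ ≤ |t - k * π|) : Real.sin δ ≤ |Real.sin t| := by
  have hπ := Real.pi_pos
  -- reduce `t` modulo `π` to `t' ∈ [0, π)`
  set k : ℤ := toIcoDiv hπ 0 t with hk
  set t' : ℝ := t - k * π with ht'
  have hmem : t' ∈ Set.Ico 0 (0 + π) := by
    have := toIcoMod_mem_Ico hπ 0 t
    rw [toIcoMod, zsmul_eq_mul] at this
    exact this
  simp only [zero_add] at hmem
  have hsin : |Real.sin t| = |Real.sin t'| := by
    rw [ht', show t - k * π = t + (-k : ℤ) * π by push_cast; ring, Real.sin_add_int_mul_pi, abs_mul,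
      abs_neg_one_zpow, one_mul]
  have h1 : δ ≤ t' := by have := h k; rwa [abs_of_nonneg hmem.1] at this
  have h2 : t' ≤ π - δ := by
    have := h (k + 1)
    rw [show t - ((k + 1 : ℤ) : ℝ) * π = t' - π by push_cast; rw [ht']; ring,
      abs_of_nonpos (by linarith [hmem.2])] at this
    linarith
  rw [hsin, abs_of_nonneg (Real.sin_nonneg_of_nonneg_of_le_pi hmem.1 hmem.2.le)]
  rcases le_or_gt t' (π / 2) with h3 | h3
  · exact Real.sin_le_sin_of_le_of_le_pi_div_two (by linarith) h3 h1
  · rw [← Real.sin_pi_sub t']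
    exact Real.sin_le_sin_of_le_of_le_pi_div_two (by linarith) (by linarith) (by linarith)

/-- **Holomorphic extension along a line from two-sided cosine moments.** Let `γ` be continuous, even,
`2π`-periodic with `∫_{-π}^{π} γ(θ) cos(nθ) dθ = ∫ yⁿ dν(y)` for a finite positive measure `ν` on
`[-1, 1]`. If `|sin(θ₀ + Re z/2)| ≥ m₀ > 0` for `‖z‖ < r`, then `F(z) = (2π)⁻¹ ∫ P_y(θ₀ + z/2) dν(y)` is
holomorphic on the disc `‖z‖ < r`, has real trace `F(s) = γ(θ₀ + s/2)`, and `‖F‖ ≤ ν(ℝ)/(2π m₀²)`.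
[folklore] -/
theorem exists_holoExt_of_cos_moments {γ : ℝ → ℝ} (hγ : Continuous γ)
    (hper : Function.Periodic γ (2 * π)) (heven : ∀ θ, γ (-θ) = γ θ)
    {ν : Measure ℝ} [IsFiniteMeasure ν] (hν : ν (Set.Icc (-1 : ℝ) 1)ᶜ = 0)
    (hmom : ∀ n : ℕ, ∫ θ in (-π)..π, γ θ * Real.cos (n * θ) = ∫ y, y ^ n ∂ν)
    (θ₀ : ℝ) {r m₀ : ℝ} (hm₀ : 0 < m₀) (hsin : ∀ z : ℂ, ‖z‖ < r → m₀ ≤ |Real.sin (θ₀ + z.re / 2)|) :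
    ∃ F : ℂ → ℂ, DifferentiableOn ℂ F (Metric.ball (0 : ℂ) r) ∧
      (∀ s : ℝ, |s| < r → F (s : ℂ) = ((γ (θ₀ + s / 2) : ℝ) : ℂ)) ∧
      (∀ z : ℂ, ‖z‖ < r → ‖F z‖ ≤ ν.real Set.univ / (2 * π * m₀ ^ 2)) := by
  have hπ := Real.pi_pos
  set Pν : ℂ → ℂ := fun θ => ∫ y, ((1 - y ^ 2 : ℝ) : ℂ) /
    (1 - 2 * (y : ℂ) * Complex.cos θ + (y : ℂ) ^ 2) ∂ν with hPν
  set a : ℂ → ℂ := fun z => (θ₀ : ℂ) + z / 2 with ha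
  have ha_re : ∀ z : ℂ, (a z).re = θ₀ + z.re / 2 := fun z => by simp [ha]
  have hsin' : ∀ z : ℂ, ‖z‖ < r → Real.sin (a z).re ≠ 0 := fun z hz h0 => by
    have := hsin z hz; rw [← ha_re, h0, abs_zero] at this; linarith
  refine ⟨fun z => ((2 * π)⁻¹ : ℂ) * Pν (a z), ?_, fun s hs => ?_, fun z hz => ?_⟩
  · refine DifferentiableOn.const_mul (DifferentiableOn.comp (differentiableOn_poissonLine ν hν)
      (by simp only [ha]; fun_prop) fun z hz => ?_) _
    exact hsin' z (by simpa using hz)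
  · have hs' : ‖(s : ℂ)‖ < r := by simpa using hs
    have h0 := hsin' s hs'
    rw [ha_re, Complex.ofReal_re] at h0
    have hc1 : Real.cos (θ₀ + s / 2) ≠ 1 := fun h => h0 (by
      have := Real.sin_sq_add_cos_sq (θ₀ + s / 2); rw [h] at this; nlinarith)
    have hc2 : Real.cos (θ₀ + s / 2) ≠ -1 := fun h => h0 (by
      have := Real.sin_sq_add_cos_sq (θ₀ + s / 2); rw [h] at this; nlinarith)
    have hrep := two_pi_mul_eq_integral_poisson_of_Icc_neg_one hγ hper heven hν hmom hc1 hc2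
    have haz : a s = ((θ₀ + s / 2 : ℝ) : ℂ) := by simp [ha]
    show ((2 * π)⁻¹ : ℂ) * Pν (a s) = _
    rw [haz]
    simp only [hPν]
    rw [poissonLine_ofReal, ← hrep]
    push_cast
    field_simp
  · have hb := norm_poissonLine_le ν hν (hsin' z hz)
    rw [norm_mul, norm_inv, Complex.norm_mul, Complex.norm_two, Complex.norm_real, Real.norm_eq_abs,
      abs_of_pos hπ]
    have hs := hsin z hz
    rw [← ha_re] at hs
    have h1 : 1 / Real.sin (a z).re ^ 2 ≤ 1 / m₀ ^ 2 := by
      refine div_le_div_of_nonneg_left zero_le_one (by positivity) ?_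
      rw [← sq_abs (Real.sin _)]
      exact pow_le_pow_left₀ hm₀.le hs 2
    calc (2 * π)⁻¹ * ‖Pν (a z)‖ ≤ (2 * π)⁻¹ * (ν.real Set.univ * (1 / m₀ ^ 2)) := by
          refine mul_le_mul_of_nonneg_left (hb.trans ?_) (by positivity)
          exact mul_le_mul_of_nonneg_left h1 measureReal_nonneg
      _ = ν.real Set.univ / (2 * π * m₀ ^ 2) := by field_simp


/-! ### The uniform bound off the reciprocal lattice -/

/-- **The symbol is `(2πℤ)³`-periodic.** [folklore] -/
theorem symbol_add_int_mul_two_pi (q : Site 3 → ℝ) (ξ : Fin 3 → ℝ) (L : Fin 3 → ℤ) :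
    ∑' x : Site 3, q x * Real.cos (phase 3 (fun j => ξ j + 2 * π * L j) x) =
      ∑' x : Site 3, q x * Real.cos (phase 3 ξ x) := by
  refine tsum_congr fun x => ?_
  congr 1
  have : phase 3 (fun j => ξ j + 2 * π * L j) x = phase 3 ξ x + ((∑ j, L j * x j : ℤ) : ℝ) * (2 * π) := by
    simp only [phase, add_mul, Finset.sum_add_distrib]
    push_cast
    rw [Finset.sum_mul]
    exact congrArg₂ (· + ·) rfl (Finset.sum_congr rfl fun j _ => by ring)
  rw [this, Real.cos_add_int_mul_two_pi]

/-- **Positivity and a uniform bound of the Green symbol function off the reciprocal lattice**: if the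
Green function is positive at the unit vectors then for every `m > 0` there is `C` with
`0 < 1 - φ(ξ)` and `(1 - φ(ξ))⁻¹ ≤ C` at every `ξ` with `‖ξ - 2πL‖_∞ ≥ m` for all `L ∈ ℤ³`. [folklore] -/
theorem exists_green_bound_of_margin (hq0 : ∀ y, 0 ≤ q y) (hqs : Summable q) (hq1 : ∑' y, q y ≤ 1)
    (hP0 : ∀ z, P 0 z = if z = 0 then 1 else 0) (hPs : ∀ j z, P (j + 1) z = ∑' y, q y * P j (z - y))
    {G : Site 3 → ℝ} (hGreen : ∀ z, HasSum (fun j => P j z) (G z)) (hGpos : ∀ m : Fin 3, 0 < G (Pi.single m 1))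
    {m : ℝ} (hm : 0 < m) :
    ∃ C : ℝ, ∀ ξ : Fin 3 → ℝ, (∀ L : Fin 3 → ℤ, m ≤ ‖fun j => ξ j - 2 * π * L j‖) →
      0 < 1 - ∑' x : Site 3, q x * Real.cos (phase 3 ξ x) ∧
      (1 - ∑' x : Site 3, q x * Real.cos (phase 3 ξ x))⁻¹ ≤ C := by
  have hπ := Real.pi_pos
  set φ : (Fin 3 → ℝ) → ℝ := fun ξ => ∑' x : Site 3, q x * Real.cos (phase 3 ξ x) with hφ
  have hφc : Continuous φ := continuous_fourier_q (d := 3) hqs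
  -- positivity at a point of the cube of norm `≥ m`
  have hposK : ∀ ξ : Fin 3 → ℝ, (∀ j, |ξ j| ≤ π) → m ≤ ‖ξ‖ → 0 < 1 - φ ξ := by
    intro ξ hξ hmξ
    have hne : ξ ≠ 0 := fun h => by rw [h, norm_zero] at hmξ; linarith
    obtain ⟨j, hj⟩ : ∃ j, ξ j ≠ 0 := by
      by_contra hcon; push Not at hcon; exact hne (funext hcon)
    refine sub_pos.2 (symbol_lt_one_of_not_mem_lattice hq0 hqs hq1 hP0 hPs hGreen hGpos ⟨j, fun z hz => ?_⟩)
    have h1 : |(z : ℝ)| * (2 * π) ≤ π := by have := hξ j; rw [hz, abs_mul, abs_of_pos Real.two_pi_pos] at this; exact this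
    have h2 : |(z : ℝ)| < 1 := by nlinarith [abs_nonneg (z : ℝ)]
    have h3 : z = 0 := by
      have : |z| < 1 := by exact_mod_cast h2
      exact Int.abs_lt_one_iff.mp this
    subst h3
    exact hj (by simpa using hz)
  -- the compact set and the minimum
  set K : Set (Fin 3 → ℝ) := {ξ | (∀ j, |ξ j| ≤ π) ∧ m ≤ ‖ξ‖} with hK
  have hKc : IsCompact K := by
    have h1 : K ⊆ Metric.closedBall 0 π := by
      intro ξ hξ
      rw [mem_closedBall_zero_iff, pi_norm_le_iff_of_nonneg hπ.le]
      exact fun j => by rw [Real.norm_eq_abs]; exact hξ.1 j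
    refine (isCompact_closedBall (0 : Fin 3 → ℝ) π).of_isClosed_subset ?_ h1
    have hA : IsClosed {ξ : Fin 3 → ℝ | ∀ j, |ξ j| ≤ π} := by
      rw [Set.setOf_forall]
      exact isClosed_iInter fun j => isClosed_le ((continuous_apply j).abs) continuous_const
    exact hA.inter (isClosed_le continuous_const continuous_norm)
  obtain ⟨ε, hε, hεK⟩ : ∃ ε : ℝ, 0 < ε ∧ ∀ ξ ∈ K, ε ≤ 1 - φ ξ := by
    rcases K.eq_empty_or_nonempty with hKe | hKne
    · exact ⟨1, one_pos, fun ξ hξ => by rw [hKe] at hξ; exact absurd hξ (Set.notMem_empty _)⟩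
    · obtain ⟨ξ₀, hξ₀K, hmin⟩ := hKc.exists_isMinOn hKne (continuous_const.sub hφc).continuousOn
      exact ⟨1 - φ ξ₀, hposK ξ₀ hξ₀K.1 hξ₀K.2, fun ξ hξ => (isMinOn_iff.mp hmin) ξ hξ⟩
  refine ⟨ε⁻¹, fun ξ hmarg => ?_⟩
  -- reduce `ξ` to the cube
  set L : Fin 3 → ℤ := fun j => toIocDiv Real.two_pi_pos (-π) (ξ j) with hL
  set ξ₀ : Fin 3 → ℝ := fun j => ξ j - 2 * π * L j with hξ₀
  have hξ₀cube : ∀ j, |ξ₀ j| ≤ π := by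
    intro j
    have h := toIocMod_mem_Ioc Real.two_pi_pos (-π) (ξ j)
    rw [toIocMod, zsmul_eq_mul] at h
    have : ξ₀ j = ξ j - (L j : ℝ) * (2 * π) := by simp only [hξ₀, hL]; ring
    rw [this, abs_le]
    constructor <;> linarith [h.1, h.2]
  have hφ₀ : φ ξ = φ ξ₀ := by
    have := symbol_add_int_mul_two_pi q ξ₀ L
    have hback : (fun j => ξ₀ j + 2 * π * L j) = ξ := funext fun j => by simp only [hξ₀]; ring
    rw [hback] at this
    exact this
  have hK₀ : ξ₀ ∈ K := ⟨hξ₀cube, hmarg L⟩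
  have h1 := hεK ξ₀ hK₀
  rw [← hφ₀] at h1
  have hpos : 0 < 1 - φ ξ := lt_of_lt_of_le hε h1
  exact ⟨hpos, by rw [inv_le_inv₀ hpos hε]; exact h1⟩

/-! ### Signed coordinate permutations -/

/-- **The symbol is invariant under signed coordinate permutations of the momentum** when the step law
is invariant under the corresponding lattice map `x ↦ (ε_{π⁻¹ i} x_{π⁻¹ i})_i`. [folklore] -/
theorem symbol_signedPerm (q : Site 3 → ℝ) (σ : Equiv.Perm (Fin 3)) (ε : Fin 3 → ℤ)
    (hε : ∀ l, ε l = 1 ∨ ε l = -1)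
    (hq : ∀ x : Site 3, q (fun i => ε (σ.symm i) * x (σ.symm i)) = q x) (ξ : Fin 3 → ℝ) :
    ∑' x : Site 3, q x * Real.cos (phase 3 (fun l => (ε l : ℝ) * ξ (σ l)) x) =
      ∑' x : Site 3, q x * Real.cos (phase 3 ξ x) := by
  have hε2 : ∀ l, ε l * ε l = 1 := fun l => by rcases hε l with h | h <;> simp [h]
  -- the lattice map as an equivalence
  let T : Site 3 ≃ Site 3 :=
    { toFun := fun x i => ε (σ.symm i) * x (σ.symm i)
      invFun := fun y l => ε l * y (σ l)
      left_inv := fun x => by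
        funext l; simp only [Equiv.symm_apply_apply]; rw [← mul_assoc, hε2, one_mul]
      right_inv := fun y => by
        funext i; simp only [Equiv.apply_symm_apply]; rw [← mul_assoc, hε2, one_mul] }
  have hT : ∀ x, T x = fun i => ε (σ.symm i) * x (σ.symm i) := fun x => rfl
  have hphase : ∀ x : Site 3, phase 3 (fun l => (ε l : ℝ) * ξ (σ l)) x = phase 3 ξ (T x) := by
    intro x
    simp only [phase, hT]
    conv_rhs => rw [← Equiv.sum_comp σ]
    refine Finset.sum_congr rfl fun l _ => ?_
    simp only [Equiv.symm_apply_apply]; push_cast; ring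
  simp_rw [hphase]
  rw [← T.tsum_eq (fun y : Site 3 => q y * Real.cos (phase 3 ξ y))]
  refine tsum_congr fun x => ?_
  rw [show q (T x) = q x from hq x]

/-! ### Frame geometry -/

/-- Every ordered pair of distinct indices of `Fin 3` is `(σ 0, σ 1)` for a permutation `σ`. [folklore] -/
theorem exists_perm_fin3 {i j : Fin 3} (hij : i ≠ j) : ∃ σ : Equiv.Perm (Fin 3), σ 0 = i ∧ σ 1 = j := by
  fin_cases i <;> fin_cases j
  · exact absurd rfl hij
  · exact ⟨1, rfl, rfl⟩
  · exact ⟨Equiv.swap 1 2, by decide, by decide⟩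
  · exact ⟨Equiv.swap 0 1, by decide, by decide⟩
  · exact absurd rfl hij
  · exact ⟨Equiv.swap 0 2 * Equiv.swap 0 1, by decide, by decide⟩
  · exact ⟨Equiv.swap 0 1 * Equiv.swap 0 2, by decide, by decide⟩
  · exact ⟨Equiv.swap 0 2, by decide, by decide⟩
  · exact absurd rfl hij

/-- **Every diagonal frame is a signed coordinate permutation of `e₀ + e₁`**: for `u = e_i ± e_j`
(`i ≠ j`) there are `σ ∈ S₃` and signs `ε_l = ±1` with `ε_l u_{σ l} = (1, 1, 0)_l`. [folklore] -/
theorem exists_signedPerm_of_diagFrame {u : Site 3}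
    (hu : ∃ i j : Fin 3, i ≠ j ∧ (u = Pi.single i 1 + Pi.single j 1 ∨ u = Pi.single i 1 - Pi.single j 1)) :
    ∃ (σ : Equiv.Perm (Fin 3)) (ε : Fin 3 → ℤ), (∀ l, ε l = 1 ∨ ε l = -1) ∧
      ∀ l, ε l * u (σ l) = (![1, 1, 0] : Fin 3 → ℤ) l := by
  obtain ⟨i, j, hij, hu⟩ := hu
  obtain ⟨σ, h0, h1⟩ := exists_perm_fin3 hij
  have h2i : σ 2 ≠ i := by rw [← h0]; exact fun h => by have := σ.injective h; exact absurd this (by decide)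
  have h2j : σ 2 ≠ j := by rw [← h1]; exact fun h => by have := σ.injective h; exact absurd this (by decide)
  rcases hu with rfl | rfl
  · refine ⟨σ, ![1, 1, 1], fun l => by fin_cases l <;> simp, fun l => ?_⟩
    fin_cases l <;> simp [h0, h1, hij, hij.symm, h2i, h2j]
  · refine ⟨σ, ![1, -1, 1], fun l => by fin_cases l <;> simp, fun l => ?_⟩
    fin_cases l <;> simp [h0, h1, hij, hij.symm, h2i, h2j]

/-- **Signed coordinate permutations preserve the sup norm.** [folklore] -/
theorem norm_signedPerm (σ : Equiv.Perm (Fin 3)) (ε : Fin 3 → ℤ) (hε : ∀ l, ε l = 1 ∨ ε l = -1)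
    (v : Fin 3 → ℝ) : ‖(fun l => (ε l : ℝ) * v (σ l))‖ = ‖v‖ := by
  have habs : ∀ l (x : ℝ), |(ε l : ℝ) * x| = |x| := fun l x => by
    rcases hε l with h | h <;> simp [h]
  refine le_antisymm ?_ ?_
  · refine (pi_norm_le_iff_of_nonneg (norm_nonneg v)).2 fun l => ?_
    rw [Real.norm_eq_abs, habs]
    exact norm_le_pi_norm (f := v) (σ l)
  · refine (pi_norm_le_iff_of_nonneg (norm_nonneg _)).2 fun i => ?_
    have h := norm_le_pi_norm (f := fun l => (ε l : ℝ) * v (σ l)) (σ.symm i)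
    simp only [Real.norm_eq_abs, habs, Equiv.apply_symm_apply] at h ⊢
    exact h

/-- **Reduction modulo the reciprocal lattice**: every momentum `p` has a lattice translate with
`p₀ - p₁ ∈ [-π, π]` and `p₂ ∈ [-π, π]`. [folklore] -/
theorem exists_lattice_shift_reduced (p : Fin 3 → ℝ) :
    ∃ L : Fin 3 → ℤ, |(p 0 - 2 * π * L 0) - (p 1 - 2 * π * L 1)| ≤ π ∧ |p 2 - 2 * π * L 2| ≤ π := by
  have h2π := Real.two_pi_pos
  have hred : ∀ a : ℝ, |a - 2 * π * (toIocDiv h2π (-π) a)| ≤ π := by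
    intro a
    have h := toIocMod_mem_Ioc h2π (-π) a
    rw [toIocMod, zsmul_eq_mul] at h
    rw [abs_le]; constructor <;> linarith [h.1, h.2]
  refine ⟨![toIocDiv h2π (-π) (p 0 - p 1), 0, toIocDiv h2π (-π) (p 2)], ?_, ?_⟩
  · simp only [Matrix.cons_val_zero, Matrix.cons_val_one, Int.cast_zero, mul_zero, sub_zero]
    have := hred (p 0 - p 1)
    rwa [show p 0 - p 1 - 2 * π * (toIocDiv h2π (-π) (p 0 - p 1)) = p 0 - 2 * π * (toIocDiv h2π (-π) (p 0 - p 1)) - p 1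
      by ring] at this
  · exact hred (p 2)

/-- A reduced nonzero coordinate is off `2πℤ`. [folklore] -/
theorem good_of_reduced_le {a : ℝ} (ha : |a| ≤ π) (ha0 : a ≠ 0) : ∀ z : ℤ, a ≠ z * (2 * π) := by
  intro z hz
  have h1 : |(z : ℝ)| * (2 * π) ≤ π := by rw [hz, abs_mul, abs_of_pos Real.two_pi_pos] at ha; exact ha
  have h2 : |(z : ℝ)| < 1 := by nlinarith [abs_nonneg (z : ℝ), Real.pi_pos]
  have h3 : z = 0 := by
    have : |z| < 1 := by exact_mod_cast h2
    exact Int.abs_lt_one_iff.mp this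
  subst h3
  exact ha0 (by simpa using hz)

/-- From a margin to `2πℤ` for `2θ₀ + 2πc` (`c ∈ ℤ`) to a margin to `πℤ` for `θ₀ + x` (`|x| < d/4`):
`d ≤ |2θ₀ + 2πc - 2πn|` for all `n` implies `d/4 ≤ |θ₀ + x - kπ|` for all `k`, and `d ≤ π`. [folklore] -/
theorem dist_pi_int_of_dist_two_pi_int {θ₀ d x : ℝ} {c : ℤ} (hd : ∀ n : ℤ, d ≤ |2 * θ₀ + 2 * π * c - 2 * π * n|)
    (hx : |x| < d / 4) : (∀ k : ℤ, d / 4 ≤ |θ₀ + x - k * π|) ∧ d ≤ π := by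
  have hπ := Real.pi_pos
  constructor
  · intro k
    have h := hd (c + k)
    rw [show 2 * θ₀ + 2 * π * c - 2 * π * ((c + k : ℤ) : ℝ) = 2 * (θ₀ - k * π) by push_cast; ring, abs_mul,
      abs_two] at h
    have h2 := abs_add_le (θ₀ + x - k * π) (-x)
    rw [show θ₀ + x - k * π + -x = θ₀ - k * π by ring, abs_neg] at h2
    linarith
  · -- the nearest point of `2πℤ` to `2θ₀ + 2πc`
    have h := hd (c + round (θ₀ / π))
    have hr := abs_sub_round (θ₀ / π)
    rw [show 2 * θ₀ + 2 * π * c - 2 * π * ((c + round (θ₀ / π) : ℤ) : ℝ) =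
      (2 * π) * (θ₀ / π - round (θ₀ / π)) by push_cast; field_simp; ring, abs_mul, abs_of_pos Real.two_pi_pos] at h
    nlinarith


/-- **Registered auxiliary stub `stub_slabModeExpDecay_auxDiagLineHol11`** (sub-goal of the brick
`stub_slabModeExpDecay_auxDiagLineHol` of `stub_slabModeExpDecay`): every diagonal frame is a signed
coordinate permutation of `e₀ + e₁` (`exists_signedPerm_of_diagFrame`). [folklore] -/
theorem stub_slabModeExpDecay_auxDiagLineHol11 : ∀ (u : Site 3), (∃ i j : Fin 3, i ≠ j ∧ (u = Pi.single i 1 + Pi.single j 1 ∨ u = Pi.single i 1 - Pi.single j 1)) → ∃ (σ : Equiv.Perm (Fin 3)) (ε : Fin 3 → ℤ), (∀ l, ε l = 1 ∨ ε l = -1) ∧ ∀ l, ε l * u (σ l) = (![1, 1, 0] : Fin 3 → ℤ) l :=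
  fun _ hu => exists_signedPerm_of_diagFrame hu

end Summit.CriticalPhenomena.Ising3DConformalLimit.Cruxes.DirectCorrelationStableTail.SelfEnergyPickInversion

end
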